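import Mathlib

/-!
# Crux `HilbertIntegralOverconvergentIsCongruence` (stmt-Langlands-8485), line `Sketch-ideate-r1-k1`:
# stub S10b — traces of products of totally positive elements are positive

Hilbert modular `q`-expansions over a totally real field `F` are indexed by totally positive
`ν ∈ F` and are moved into `ℕ^d` by the exponent encoding `ν ↦ (Tr(α_j ν))_j` with totally
positive `α_j`.  This file proves the positivity needed for that encoding:

* `stub_tracePosOfTotallyPositive` (registered stub S10b) — for a totally real number field `F`
  and `α, ν ∈ F` positive under every real embedding, `0 < Tr_{F/ℚ}(α ν)`.

Proof: `Tr_{F/ℚ}(αν) = Σ_σ σ(αν)` over the complex embeddings `σ` (Mathlib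
`trace_eq_sum_embeddings`); since `F` is totally real every `σ` is real
(`NumberField.IsTotallyReal.complexEmbedding_isReal`), so `σ(αν) = τ(α) τ(ν) > 0` for the real
embedding `τ` underlying `σ`, and the (nonempty) sum of positive reals is positive.

Theorems only, no `sorry`.
-/

set_option linter.dupNamespace false

namespace Summit.Langlands.Langlands.Theorems.HilbertIntegralOverconvergentIsCongruence

open NumberField

/-- **stub S10b — `stub_tracePosOfTotallyPositive` (S; exponent encoding, positivity).**  In a totally real
number field the trace of a product of two totally positive elements is positive
(`Tr(αν) = Σ_τ τ(α)τ(ν)` over the real embeddings, Mathlib `Algebra.trace_eq_sum_embeddings` with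
`NumberField.IsTotallyReal`). [folklore] -/
theorem stub_tracePosOfTotallyPositive (F : Type*) [Field F] [NumberField F] [NumberField.IsTotallyReal F]
    (α ν : F) (hα : ∀ τ : F →+* ℝ, 0 < τ α) (hν : ∀ τ : F →+* ℝ, 0 < τ ν) :
    0 < Algebra.trace ℚ F (α * ν) := by
  classical
  -- every complex embedding of the totally real field `F` is real
  have hreal : ∀ σ : F →ₐ[ℚ] ℂ, ComplexEmbedding.IsReal (σ : F →+* ℂ) := fun σ =>
    IsTotallyReal.complexEmbedding_isReal _
  -- each term of the embedding sum is the real number `τ(α) τ(ν)`, where `τ` is the real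
  -- embedding underlying `σ`
  have hterm : ∀ σ : F →ₐ[ℚ] ℂ,
      σ (α * ν) = (((hreal σ).embedding α * (hreal σ).embedding ν : ℝ) : ℂ) := by
    intro σ
    rw [Complex.ofReal_mul, ComplexEmbedding.IsReal.coe_embedding_apply,
      ComplexEmbedding.IsReal.coe_embedding_apply, ← map_mul]
    rfl
  -- trace as a sum over the complex embeddings, identified with a real sum
  have hsum : ((Algebra.trace ℚ F (α * ν) : ℚ) : ℂ) =
      ((∑ σ : F →ₐ[ℚ] ℂ, (hreal σ).embedding α * (hreal σ).embedding ν : ℝ) : ℂ) := by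
    have h := trace_eq_sum_embeddings ℂ (K := ℚ) (L := F) (x := α * ν)
    rw [eq_ratCast] at h
    rw [h, Complex.ofReal_sum]
    exact Finset.sum_congr rfl fun σ _ => hterm σ
  -- the real sum is positive: positive terms over a nonempty index set
  have hpos : 0 < ∑ σ : F →ₐ[ℚ] ℂ, (hreal σ).embedding α * (hreal σ).embedding ν := by
    have hnonempty : (Finset.univ : Finset (F →ₐ[ℚ] ℂ)).Nonempty := by
      have hcard : 0 < Fintype.card (F →ₐ[ℚ] ℂ) := by
        rw [AlgHom.card ℚ F ℂ]; exact Module.finrank_pos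
      obtain ⟨σ⟩ := Fintype.card_pos_iff.mp hcard
      exact ⟨σ, Finset.mem_univ _⟩
    exact Finset.sum_pos (fun σ _ => mul_pos (hα _) (hν _)) hnonempty
  -- transfer back to `ℚ`
  have hq : ((Algebra.trace ℚ F (α * ν) : ℚ) : ℝ) =
      ∑ σ : F →ₐ[ℚ] ℂ, (hreal σ).embedding α * (hreal σ).embedding ν := by
    have h1 : (((Algebra.trace ℚ F (α * ν) : ℚ) : ℝ) : ℂ) =
        ((Algebra.trace ℚ F (α * ν) : ℚ) : ℂ) := by
      norm_cast
    exact_mod_cast h1.trans hsum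
  exact_mod_cast (hq ▸ hpos : (0 : ℝ) < ((Algebra.trace ℚ F (α * ν) : ℚ) : ℝ))

end Summit.Langlands.Langlands.Theorems.HilbertIntegralOverconvergentIsCongruence
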